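import Literature.NumberTheory.ComplexMultiplication.PartialConjugationOfConjSqrt
import Summits.HodgeConjecture.CorCM.SmallIntersectionCMFieldsHodge
import Summits.HodgeConjecture.CorCM.QuarticCMConjugationSquare
import HarnessLib

/-!
# A square root of conjugation on one side, a degree `≢ 0 (mod 4)` on the other: the Hodge conjecture for
# `A₀^a × A₁^b` without computing `L₀ ∩ L₁` — e.g. a simple CM threefold with Galois CM field times ANY simple CM surface

COR-CM (cell `pub-hodgecm2`, binder seat `b23` gen 28), count-neutral; NEW as stated, hence under `Summits/`.  Sequel of
`Summits/HodgeConjecture/CorCM/RealIntersectionCMFieldsHodge` and `…/SmallIntersectionCMFieldsHodge` through the literature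
file `Literature.NumberTheory.ComplexMultiplication.PartialConjugationOfConjSqrt` (this seat): if (□) some `τ ∈ Aut(ℂ)` has
`τ ∘ τ ∘ s = s̄` for every embedding `s` of `K_{i₁}` and `4 ∤ [L_{i₀} : ℚ]` (`L_i` the Galois closures in `ℂ`), both slots
carry partial conjugations — `τ|_{L₀ ∩ L₁}` would otherwise have order `4`.  The instances of (□) are the cell's:
`QuarticCM.exists_ringAut_smul_smul_eq_conjugate` (NON-Galois quartic CM fields, seat p2),
`ConjSquare.exists_ringAut_smul_smul_eq_conjugate_of_isSquare_conjGal` / `_of_isCyclic` / `_of_card_eq_eight` (Galois CM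
fields whose conjugation is a square: cyclic of degree `≡ 0 (mod 4)`, dihedral/quaternion octics; seats p2/b23).

* **`hodgeConjectureFor_prod_pair_of_smul_smul_of_not_dvd`** — (□) at `i₁`, `4 ∤ [L_{i₀} : ℚ]`, nondegenerate types:
  the Hodge conjecture for every `A₀^a × A₁^b` (every `⨁_{j<N} A_{π j}`) of realisations; with `K_{i₀}` imaginary
  quadratic (`[L_{i₀} : ℚ] = 2`) this is p2's `hodgeConjectureFor_prod_of_quadratic_of_smul_smul`, here for every
  `K_{i₀}` whose Galois closure has degree `≡ 2 (mod 4)` (Galois CM fields of degree `≡ 2 (mod 4)`: cyclic sextics,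
  `ℚ(ζ_7)`, `ℚ(ζ_9)`, `ℚ(ζ_p)` for `p ≡ 3 (mod 4)`, …);
* `hodgeConjectureFor_prod_pair_of_isSquare_conjGal_of_not_dvd`, `hodgeConjectureFor_prod_pair_of_not_isGalois_quartic_of_not_dvd`
  — the two sources of (□);
* **`hodgeConjectureFor_prod_galoisSextic_simpleSurface`** — the packaged instance: `A₀` a realisation of a PRIMITIVE CM
  type of a GALOIS SEXTIC CM field (a simple CM threefold with cyclic CM field, e.g. `ℚ(ζ_7)`, `ℚ(ζ_9)`, `ℚ(√−3)·ℚ(ζ_7)⁺`),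
  `A₁` a realisation of ANY CM type of ANY quartic CM field that is not biquadratic (= every SIMPLE CM abelian surface:
  cyclic Galois or non-Galois quartic field, all types primitive): **the Hodge conjecture for all `A₀^a × A₁^b`**,
  UNCONDITIONALLY and without any disjointness hypothesis to check (here the closures turn out to meet trivially — the
  imaginary quadratic subfield of the sextic cannot lie in a field with (□) — but no intersection is ever computed).

Everything is a short application; theorems only, no definition, no `sorry`.

## References

* [Shimura1998] G. Shimura, *Abelian Varieties with Complex Multiplication and Modular Functions*, §8.4 Example (2).
* [Gordon1999HodgeAVSurvey] B. B. Gordon, *A survey of the Hodge conjecture for abelian varieties*, §3 Theorem (Imai,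
  Murty) and proof; 7.5; 10.10.
* [Lang2002] S. Lang, *Algebra*, 3rd ed., VI §1 Thm. 1.1, Cor. 1.4.
-/

noncomputable section

open CategoryTheory CategoryTheory.Limits NumberField IntermediateField Module

namespace Summit.HodgeConjecture.CorCM

open Literature.NumberTheory.ComplexMultiplication
open Literature.AlgebraicGeometry.Motives (AbelianVariety CMType)
open Literature.AlgebraicGeometry.HodgeTheory
open Literature.AlgebraicGeometry.ComplexMultiplication (IsCMTypeRealisation)
open Literature.AlgebraicGeometry.VanGeemen1994 (hodgeClassSpan)
open Literature.AlgebraicGeometry.Pohlmann1968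
open Literature.Barriers.HodgeConjecture (divisorClassesSpan)

section Geometry

variable {I : Type} {K : I → Type} [∀ i, Field (K i)] [∀ i, NumberField (K i)] [∀ i, IsCMField (K i)] [Fintype I]
  [Nonempty I] {Φ : ∀ i, CMType (K i)}
variable {A : I → AbelianVariety ℂ} {ι : ∀ i, 𝓞 (K i) →+* End (A i)}
  {θ : ∀ i, K i →+* Module.End ℂ (complexBetti (A i).X 1)}

/-- **(□) at `i₁` and `4 ∤ [L_{i₀} : ℚ]`: the Hodge conjecture for every `A₀^a × A₁^b`** (every `⨁_{j<N} A_{π j}`) of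
realisations of nondegenerate CM types — a square root of complex conjugation on `Hom(K_{i₁}, ℂ)` inside `Aut(ℂ)` and a
Galois closure `L_{i₀}` of degree not divisible by `4` force conjugation to fix `L_{i₀} ∩ L_{i₁}` pointwise, so both slots
carry partial conjugations and the product is stably nondegenerate. [cite: Gordon1999HodgeAVSurvey, §3 Theorem and 10.10] -/
theorem hodgeConjectureFor_prod_pair_of_smul_smul_of_not_dvd {i₀ i₁ : I} (h01 : i₀ ≠ i₁) (hI : ∀ j, j = i₀ ∨ j = i₁)
    (hτ : ∃ τ : ℂ ≃+* ℂ, ∀ s : K i₁ →+* ℂ, τ • τ • s = (starRingAut : ℂ ≃+* ℂ) • s)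
    (h4 : ¬ 4 ∣ finrank ℚ (normalClosure ℚ (K i₀) ℂ))
    (hΦ : ∀ i, IsNondegenerate (Φ i)) (hA : ∀ i, IsCMTypeRealisation (Φ i) (A i) (ι i) (θ i)) {N : ℕ}
    (π : Fin N → I) :
    HodgeConjectureFor (⨁ fun j : Fin N => A (π j)).dim (⨁ fun j : Fin N => A (π j)).X :=
  hodgeConjectureFor_prod_of_partialConj (forall_exists_partialConj_pair_of_smul_smul_of_not_dvd h01 hI hτ h4) hΦ hA π

/-- **Square `conjGal` at `i₁` and `4 ∤ [L_{i₀} : ℚ]`**: `K_{i₁}` Galois CM with complex conjugation a square in its Galois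
group (cyclic of degree `≡ 0 (mod 4)`, dihedral/quaternion octics, …), nondegenerate types: the Hodge conjecture for every
`A₀^a × A₁^b`. [cite: Gordon1999HodgeAVSurvey, §3 Theorem and 10.10] -/
theorem hodgeConjectureFor_prod_pair_of_isSquare_conjGal_of_not_dvd {i₀ i₁ : I} (h01 : i₀ ≠ i₁)
    (hI : ∀ j, j = i₀ ∨ j = i₁) [IsGalois ℚ (K i₁)] (hsq : IsSquare (conjGal : K i₁ ≃ₐ[ℚ] K i₁))
    (h4 : ¬ 4 ∣ finrank ℚ (normalClosure ℚ (K i₀) ℂ))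
    (hΦ : ∀ i, IsNondegenerate (Φ i)) (hA : ∀ i, IsCMTypeRealisation (Φ i) (A i) (ι i) (θ i)) {N : ℕ}
    (π : Fin N → I) :
    HodgeConjectureFor (⨁ fun j : Fin N => A (π j)).dim (⨁ fun j : Fin N => A (π j)).X :=
  hodgeConjectureFor_prod_of_partialConj
    (forall_exists_partialConj_pair_of_isSquare_conjGal_of_not_dvd h01 hI hsq h4) hΦ hA π

/-- **A NON-Galois quartic CM field at `i₁` and `4 ∤ [L_{i₀} : ℚ]`**: (□) holds for every non-Galois quartic CM field
(`QuarticCM.exists_ringAut_smul_smul_eq_conjugate`, the `4`-cycle of the dihedral closure) and every CM type of such a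
field is primitive hence nondegenerate; so for a nondegenerate `Φ_{i₀}` the Hodge conjecture holds for every `A₀^a × A₁^b`.
[cite: Shimura1998, §8.4 Example (2)(C)] [cite: Gordon1999HodgeAVSurvey, §3 Theorem and 10.10] -/
theorem hodgeConjectureFor_prod_pair_of_not_isGalois_quartic_of_not_dvd {i₀ i₁ : I} (h01 : i₀ ≠ i₁)
    (hI : ∀ j, j = i₀ ∨ j = i₁) (h4₁ : finrank ℚ (K i₁) = 4) (hK₁ : ¬ IsGalois ℚ (K i₁))
    (h4 : ¬ 4 ∣ finrank ℚ (normalClosure ℚ (K i₀) ℂ)) (hΦ₀ : IsNondegenerate (Φ i₀))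
    (hA : ∀ i, IsCMTypeRealisation (Φ i) (A i) (ι i) (θ i)) {N : ℕ} (π : Fin N → I) :
    HodgeConjectureFor (⨁ fun j : Fin N => A (π j)).dim (⨁ fun j : Fin N => A (π j)).X := by
  refine hodgeConjectureFor_prod_pair_of_smul_smul_of_not_dvd h01 hI ?_ h4 (fun i => ?_) hA π
  · obtain ⟨τ, hτ⟩ := QuarticCM.exists_ringAut_smul_smul_eq_conjugate h4₁ hK₁
    exact ⟨τ, fun s => by rw [conj_smul_eq_conjugate]; exact hτ s⟩
  · rcases hI i with rfl | rfl
    · exact hΦ₀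
    · obtain ⟨φ₀⟩ : Nonempty (K i →+* ℂ) := inferInstance
      exact isNondegenerate_of_isPrimitive_of_finrank_le_six (Φ := Φ i) (by omega) φ₀
        (isPrimitive_of_not_isGalois h4₁ hK₁ (Φ i) φ₀)

/-- **A Galois sextic CM field with a primitive type times ANY simple CM abelian surface.**  Let `K_{i₀}` be a CM field of
degree `6`, Galois over `ℚ` (cyclic sextic: `ℚ(ζ_7)`, `ℚ(ζ_9)`, `k·C` for an imaginary quadratic `k` and a cyclic cubic
`C`), `Φ_{i₀}` PRIMITIVE (a simple CM threefold), and `K_{i₁}` a quartic CM field which is NOT biquadratic (cyclic Galois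
or non-Galois: every CM type primitive — every simple CM abelian surface), `Φ_{i₁}` arbitrary.  Then **every `A₀^a × A₁^b`
of realisations satisfies the Hodge conjecture**, UNCONDITIONALLY: `[L_{i₀} : ℚ] = 6 ≢ 0 (mod 4)` and (□) holds at `i₁`.
(The closures here meet in `ℚ` — the imaginary quadratic subfield of the sextic cannot sit in a field with (□) — but no
intersection is computed.) [cite: Shimura1998, §8.4 Example (2)] [cite: Gordon1999HodgeAVSurvey, §3 Theorem and 10.10] -/
theorem hodgeConjectureFor_prod_galoisSextic_simpleSurface {i₀ i₁ : I} (h01 : i₀ ≠ i₁) (hI : ∀ j, j = i₀ ∨ j = i₁)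
    [IsGalois ℚ (K i₀)] (h6 : finrank ℚ (K i₀) = 6) (φ₀ : K i₀ →+* ℂ)
    (hprim : IsPrimitive (ℂ ≃+* ℂ) (Φ i₀).1 φ₀) (h4₁ : finrank ℚ (K i₁) = 4)
    (hK₁ : ¬ (IsGalois ℚ (K i₁) ∧ ¬ IsCyclic (K i₁ ≃ₐ[ℚ] K i₁)))
    (hA : ∀ i, IsCMTypeRealisation (Φ i) (A i) (ι i) (θ i)) {N : ℕ} (π : Fin N → I) :
    HodgeConjectureFor (⨁ fun j : Fin N => A (π j)).dim (⨁ fun j : Fin N => A (π j)).X := by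
  have h4 : ¬ 4 ∣ finrank ℚ (normalClosure ℚ (K i₀) ℂ) := by
    rw [finrank_normalClosure_of_normal (K := K i₀), h6]
    decide
  have hΦ₀ : IsNondegenerate (Φ i₀) := isNondegenerate_of_isPrimitive_of_finrank_le_six (Φ := Φ i₀) (by omega) φ₀ hprim
  by_cases hgal : IsGalois ℚ (K i₁)
  · -- cyclic Galois quartic: conjugation is a square
    have hcyc : IsCyclic (K i₁ ≃ₐ[ℚ] K i₁) := by
      by_contra hc
      exact hK₁ ⟨hgal, hc⟩
    haveI := hgal
    haveI := hcyc
    refine hodgeConjectureFor_prod_pair_of_isSquare_conjGal_of_not_dvd h01 hI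
      (isSquare_conjGal_of_isCyclic (by rw [h4₁])) h4 (fun i => ?_) hA π
    rcases hI i with rfl | rfl
    · exact hΦ₀
    · exact isNondegenerate_of_isCyclic_of_finrank_eq_four h4₁ (Φ _)
  · exact hodgeConjectureFor_prod_pair_of_not_isGalois_quartic_of_not_dvd h01 hI h4₁ hgal h4 hΦ₀ hA π

end Geometry

end Summit.HodgeConjecture.CorCM

end
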